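import Summits.BirchSwinnertonDyer.Rank1Residual.GaloisImage.CyclotomicLevelGenerators
import HarnessLib

/-!
# Frobenius elements in the cyclotomic levels over `ℚ` (T-DER support, layer `i ≥ 1`: the
# binders `hFrp` / `hσp` of `Derivative.conjMap_deriv_eq`; cell `b2b-bsdres`, team n1011)

HONEST FRAMING (cell `b2b-bsdres`, run/shared/lean/b2b/bsd-rank1-residual/, verbatim in every
file): the goal of the cell is to DELETE the COMBINATION-SHAPED residual classes of the
Birch–Swinnerton-Dyer formula for ALL analytic-rank `≤ 1` elliptic curves over `ℚ` — "full BSD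
formula for every rank `≤ 1` curve in class `C`" assembled STRICTLY from published theorems — so
that the rank-`≤ 1` remainder becomes exactly the CONSTRUCTION-SHAPED classes, which are TYPED
(missing-input `Prop`s), NOT attempted. This is not "finishing BSD". Team n1011 (N10/N11, the
additive block `X4 ∧ p = 3`): research route on the CONSTRUCTION-SHAPED class X4 / §I N11; TOOL
theorems of Galois theory only (p-free, curve-free); nothing is booked; no mark / label / flag
text moves; census −0.

ROW T-DER (n1011-p11) states THEOREM A2 (`Derivative.conjMap_deriv_eq`) at an arbitrary
`K_∞`-layer `i`, with the binders `hσp : σ ℓ ∈ L.pLevel i` and `hFrp : Fr ℓ ∈ L.pLevel i`.  For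
`L = cyclotomicLevelsRat p S` (`pLevel k = Gal(ℚ̄/ℚ(μ_{p^k}))`) these say that `σ_ℓ` and the
arithmetic Frobenius `Fr_ℓ` fix `μ_{p^k}`: the first is the prime-to-`ℓ` clause of
`CyclotomicLevelGenerators` (`Rat.exists_sigma_cyclotomicLevelsRat`, conjunct 4); the second holds
iff `ℓ ≡ 1 (mod p^k)` — the defining congruence of a Kolyvagin prime of level `k` — because an
arithmetic Frobenius at `ℓ ∤ n` acts on `μ_n` by `ζ ↦ ζ^ℓ` (tree
`modNCyclotomicCharacter_eq_residueCard_of_isArithFrobAt`, Neukirch I (10.3)).  At the bottom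
layer `i = 0` both binders are vacuous (`pLevel 0 = ⊤`).  Theorems only; 0 defs, 0 facts, 0 sorry.
-/

noncomputable section

open Field
open scoped NumberField

namespace Summit.BirchSwinnertonDyer.Rank1Residual.GaloisImage.CyclotomicLevel.Rat

open Literature.NumberTheory.GaloisRepresentations IsDedekindDomain

/-- **An arithmetic Frobenius at `ℓ` acts on `μ_n(ℚ̄)`, `ℓ ∤ n`, through `ℓ mod n`**:
`χ_n(Fr_ℓ) = ℓ` for every arithmetic Frobenius `Fr_ℓ ∈ Γ_ℚ` at the place `v = ℓ`
(`IsArithFrobAtPlace`).  Neukirch, *ANT* I (10.3); Washington Lemma 2.12. [folklore] -/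
theorem modNCyclotomicCharacter_of_isArithFrobAtPlace {n : ℕ} [NeZero n]
    {v : HeightOneSpectrum (𝓞 ℚ)}
    (hn : ¬ ((Rat.HeightOneSpectrum.primesEquiv v : Nat.Primes) : ℕ) ∣ n)
    {Fr : absoluteGaloisGroup ℚ} (hFr : IsArithFrobAtPlace ℚ v Fr) :
    (modNCyclotomicCharacter ℚ n Fr : ZMod n) =
      ((Rat.HeightOneSpectrum.primesEquiv v : Nat.Primes) : ℕ) := by
  obtain ⟨𝔓, h𝔓, hφ⟩ := hFr
  haveI := h𝔓.1
  have hres : v.residueCard = Rat.HeightOneSpectrum.natGenerator v := by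
    have h : Ideal.span {(Rat.HeightOneSpectrum.natGenerator v : ℤ)} =
        v.asIdeal.map (Rat.IsIntegralClosure.intEquiv (𝓞 ℚ) : 𝓞 ℚ →+* ℤ) :=
      Rat.HeightOneSpectrum.span_natGenerator v
    rw [v.residueCard_eq_card_quotient, Nat.card_congr ((Ideal.quotientEquiv _ _
      (Rat.IsIntegralClosure.intEquiv (𝓞 ℚ)) h).trans (Int.quotientSpanNatEquivZMod _)).toEquiv,
      Nat.card_zmod]
  rw [modNCyclotomicCharacter_eq_residueCard_of_isArithFrobAt h𝔓
    (Rat.natCast_not_mem_of_mem_primesAbove_of_not_dvd h𝔓 hn) hφ, hres]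
  rfl

/-- **`hFrp` for the cyclotomic levels over `ℚ`**: an arithmetic Frobenius at `ℓ` fixes `μ_n(ℚ̄)`
(`Fr_ℓ ∈ Gal(ℚ̄/ℚ(μ_n))`) as soon as `ℓ ≡ 1 (mod n)` and `ℓ ∤ n` — for `n = p^k` this is the
level-`k` Kolyvagin congruence `ℓ ≡ 1 (mod p^k)` (`Kato.IsKolyvaginPrime`, third conjunct).
[folklore] -/
theorem mem_rootsOfUnityFixer_of_isArithFrobAtPlace_of_modEq {n : ℕ} [NeZero n]
    {v : HeightOneSpectrum (𝓞 ℚ)}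
    (hn : ¬ ((Rat.HeightOneSpectrum.primesEquiv v : Nat.Primes) : ℕ) ∣ n)
    (hmod : ((Rat.HeightOneSpectrum.primesEquiv v : Nat.Primes) : ℕ) ≡ 1 [MOD n])
    {Fr : absoluteGaloisGroup ℚ} (hFr : IsArithFrobAtPlace ℚ v Fr) :
    Fr ∈ rootsOfUnityFixer ℚ n := by
  rw [rootsOfUnityFixer_eq_ker, MonoidHom.mem_ker]
  apply Units.ext
  rw [modNCyclotomicCharacter_of_isArithFrobAtPlace hn hFr, Units.val_one, ← Nat.cast_one]
  exact (ZMod.natCast_eq_natCast_iff _ _ _).mpr hmod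

/-- **`hFrp` in the currency of `cyclotomicLevelsRat p S`**: at layer `k`, an arithmetic Frobenius
at a usable place `ℓ` with `ℓ ≡ 1 (mod p^k)` lies in `pLevel k = Gal(ℚ̄/ℚ(μ_{p^k}))`. [folklore] -/
theorem frobenius_mem_pLevel_cyclotomicLevelsRat (p : ℕ) [Fact p.Prime]
    (S : Set (HeightOneSpectrum (𝓞 ℚ))) (k : ℕ) {ℓ : HeightOneSpectrum (𝓞 ℚ)}
    (hℓ : ℓ ∈ (cyclotomicLevelsRat p S).primes)
    (hmod : ((Rat.HeightOneSpectrum.primesEquiv ℓ : Nat.Primes) : ℕ) ≡ 1 [MOD p ^ k])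
    {Fr : absoluteGaloisGroup ℚ} (hFr : IsArithFrobAtPlace ℚ ℓ Fr) :
    Fr ∈ (cyclotomicLevelsRat p S).pLevel k := by
  haveI : NeZero (p ^ k) := ⟨pow_ne_zero k (Fact.out : p.Prime).ne_zero⟩
  have hne : ((Rat.HeightOneSpectrum.primesEquiv ℓ : Nat.Primes) : ℕ) ≠ p :=
    ((mem_cyclotomicLevelsRat_primes_iff p S ℓ).mp hℓ).2
  have hndvd : ¬ ((Rat.HeightOneSpectrum.primesEquiv ℓ : Nat.Primes) : ℕ) ∣ p ^ k := fun h ↦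
    hne ((Nat.prime_dvd_prime_iff_eq (Rat.HeightOneSpectrum.primesEquiv ℓ).2 Fact.out).mp
      ((Rat.HeightOneSpectrum.primesEquiv ℓ).2.dvd_of_dvd_pow h))
  exact mem_rootsOfUnityFixer_of_isArithFrobAtPlace_of_modEq hndvd hmod hFr

/-- **`hσp` in the currency of `cyclotomicLevelsRat p S`**: a `σ_ℓ` fixing every root of unity of
order prime to `ℓ` (the fourth conjunct of `Rat.exists_sigma_cyclotomicLevelsRat`) lies in every
`pLevel k` when `ℓ` is usable (`ℓ ≠ p`). [folklore] -/
theorem sigma_mem_pLevel_cyclotomicLevelsRat (p : ℕ) [Fact p.Prime]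
    (S : Set (HeightOneSpectrum (𝓞 ℚ))) (k : ℕ) {ℓ : HeightOneSpectrum (𝓞 ℚ)}
    (hℓ : ℓ ∈ (cyclotomicLevelsRat p S).primes) {σ : absoluteGaloisGroup ℚ}
    (hσ : ∀ m : ℕ, (((Rat.HeightOneSpectrum.primesEquiv ℓ : Nat.Primes) : ℕ)).Coprime m →
      σ ∈ rootsOfUnityFixer ℚ m) :
    σ ∈ (cyclotomicLevelsRat p S).pLevel k := by
  have hne : ((Rat.HeightOneSpectrum.primesEquiv ℓ : Nat.Primes) : ℕ) ≠ p :=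
    ((mem_cyclotomicLevelsRat_primes_iff p S ℓ).mp hℓ).2
  exact hσ (p ^ k) (((Nat.coprime_primes (Rat.HeightOneSpectrum.primesEquiv ℓ).2 Fact.out).mpr
    hne).pow_right k)

end Summit.BirchSwinnertonDyer.Rank1Residual.GaloisImage.CyclotomicLevel.Rat

end
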